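import Literature.MathematicalPhysics.QuantumFieldTheory.Balaban1983to89.B9Eq342GreenPrimeDstarValueRowTower
import Literature.MathematicalPhysics.QuantumFieldTheory.Balaban1983to89.B9Eq342TowerGradientRowMajorant

/-!
# `Balaban1983to89.B9Eq342TowerAdjointRowMajorant` — T. Bałaban, *Propagators for lattice gauge theories in a background field*, Commun. Math. Phys. **99** (1985)
# 389–434 [Balaban1985BackgroundPropagators] Thm 3.1 (3.42)₃ p. 397 («|(G′(U)∇*_Uλ)(x, c)| ≦ B₀Lʲη…e^{−δ₀d(y,y′)}») with (3.3) p. 390, (3.8) p. 392 and [Balaban1984PropagatorsII] (2.51)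
# p. 232: **THE THIRD (ADJOINT-SIDE) THEOREM-3.1 INPUT OF THE SECT. B PROGRAMME AT THE NE9 CHAIN's `k`-LEVEL SITE PROPAGATOR — `h342_3` of
# `B9Thm34SectBUniform(R1).thm34_Gp_uniform` (`conj b (readA φ G′_k(U)) · conj b (∇_l) ≺ B_G·len·e^{−δ₀d}` for every difference letter `∇_l`, `l ∈ κ ⊕ κ`) over `towerGeom`,
# constants BEFORE the height, ON PRINT's CLASS** — this lineage's X10 row `B9Eq342GreenPrimeDstarValueRowTower.exists_valueRow_GpOfUk_covDiv` (`‖(G′_kD*_Uf)(x)‖ ≤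
# B_a·e^{−δ_a d_m(Πx, v)}·‖f‖_∞` for bond sources over one big block): the backward letter `G′(η⁻¹D*_μg)` IS `G′D*_U` of the bond field `δ_{νμ}g`; the forward letter uses
# `D_μg = D*_μa′` with `a′(z) = −R(U_μ(z))g(z + e_μ)` (a bond field over the `≤ 3^d` neighbouring big blocks, summed block by block); junction item (j4)₃ of the NE9 lineage's
# route memo `ROUTE-J-VIA-THM34-g98.md` — with (j4)₁ `B9Eq342TowerValueRowMajorant` and (j4)₂ `B9Eq342TowerGradientRowMajorant` ALL THREE Theorem-3.1 inputs of `thm34_Gp_uniform`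
# are now the chain's own rows

statement-level skeleton of published theorems with citation tags; proofs where landed; nothing here is a claim about the Yang–Mills mass gap

CITATION HEADER (lean-in-tree rule).  Audit cell `pub-balaban`, sub-cell `t4`, BINDER row NE9; NE9 crux-team LEAF PROVER 01 (`b2b-balaban-t4-ne9-formalise-leaf-01`,
gen 99; bears_on: R4/N22).  Vocabulary BY NAME: this lineage's X10 `B9Eq342GreenPrimeDstarValueRowTower.exists_valueRow_GpOfUk_covDiv` (g93; the cell's road to (3.42)₃ on its
MODEL, `3 ≤ L`), `B9Eq349BlockMultipliers.exists_block_clm_family` (bond-block projections), g98's `B9Eq323SiteLaplacianJunction.phi_covDivL2K`, r06's `B9Eq352GradLetters.diffLetter`,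
`B9Eq352DivFormLetters.gradLetterF`∕`gradLetterB`, `B9Eq39Adjoint.R`∕`covD`∕`covDstar`, this lineage's `B9Eq342MajorantReadingSeam.hasMajorant_conj_of_blockRow`,
`B9Eq342TowerGradientRowMajorant` (`norm_R_le_of_norm_le_one`, `tdist_blkK_shift_le_one`), `B9Eq341TowerBlockGeometry`, `B9Eq349LaplacePrimeBlockLetters.card_tdist_le_one_le` (`3^d`
neighbouring blocks).  Sources read through those files' verbatim quotations: [Balaban1985BackgroundPropagators] p. 397 Thm 3.1 (3.42), p. 390 (3.3), p. 392 (3.8), p. 399 (3.49);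
[Balaban1984PropagatorsII] p. 232 (2.51).  [folklore] COMPOSITION BY NAME; NOTHING of print's proofs is reproduced.

WHAT IS PROVED (sorry-free; proof lane — no `def`).
* §1 `covDstar_zero_fun`, **`covD_eq_covDstar_antider`** (`D_μg = D*_μa′`, `a′(z) = −R(U_μ(z))g(T_μz)`), **`phi_G_covDivL2K_single`** (for any operator `G` of the `L²` site carrier and any
  `𝔸`-valued `w`: `(readA φ G)(η⁻¹D*_μw)(x) = φ((G(D*_U A_w))(x))` with the bond field `A_w(z, ν) = δ_{νμ}φ⁻¹(w z)`).
* §2 **`exists_hasMajorant_GpOfUk_diffLetter`** — `∃ α_a B_G δ₀ > 0` BEFORE the height such that, on the chain's class with the bond-gradient datum (`α ≤ α_a`), at every height on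
  print's diagonal, every period, ANY `hpos′`, ANY `M, R_r, H`, EVERY `l : Fin d ⊕ Fin d`:
  `HasMajorant (toB6 (towerGeom …) R_r H) (fun p => blkK p.1) (conj b (readA φ (G′_k(U))) * conj b (diffLetter T U_d η⁻¹ l)) (fun a a′ => B_G·len(a)·e^{−δ₀·d(a,a′)})` — LITERALLY
  `h342_3` of `thm34_Gp_uniform` (`len = 1` on the diagonal; `δ₀ := δ_a∕d`; `B_G ∝ 3^d e^{δ_a} M_φM_φ′B_a M₂Σ‖b_i‖`).
HONEST SCOPE.  Composition of X10 (cell constants, NOT print's `B₀(d, L)`), the antiderivative identity, the neighbouring-block sum and the seam; the row is the cell's MODEL of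
(3.42)₃ («NE9 ⇐ the named binders»; O-NE9-1, #5 UNRULED); NE9 NOT PRINTED ∕ NOT PROVED; spine PROVED 0∕9; rung (B)+1 finite T⁴ — NOT infinite volume, NOT mass gap, NOT BetaPertH,
NOT Clay.  HONEST DEPENDENCY: continuum YM on T⁴ ⇐ BetaPertH ∧ nine spine estimates (0/9 proved); BetaPertH ⇐ (D1) ∧ (D4) ∧ CAP+tail; G-an2-4 gates asym, D1 and NE2/3/4.  NEW file;
nothing modified.  Net new unproved facts: 0.
-/

noncomputable section

open scoped BigOperators InnerProductSpace

namespace Literature.MathematicalPhysics.QuantumFieldTheory.Balaban1983to89.B9Eq342TowerAdjointRowMajorant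

open B4Sect5Torus (TSite tdist tdist_triangle tdist_symm)
open B4Sect5Proof (latticeConst latticeConst_nonneg)
open B7Prop1Explicit (U1)
open B9SectCLatticeCarrier (Bond bpos btgt shift unshift shift_unshift unshift_shift)
open B9Eq311L2Pairing (WL2)
open B11Eq103H1Complex (SiteL2K BondL2K covDivL2K)
open B9Eq310HessianOperator (adTransportW)
open B9Eq319QprimeTorus (blockCoord)
open B9Eq315QTower (towerP UlevOf)
open B9Eq316TowerFlatIsOneStep (towerP_eq_fineP_pow siteCast)
open B9Eq324DeltaPrimeATower (laplacePrimeAk GpOfUk)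
open B9Eq342GreenPrimeDstarValueRowTower (exists_valueRow_GpOfUk_covDiv)
open B9Eq349BlockMultipliers (exists_block_clm_family)
open B6RandomWalk (HasMajorant hasMajorant_mono)
open B9Thm34Ext (toB6)
open B9Eq39Adjoint (R R_neg R_zero R_inv_R covD covDstar)
open B9Eq33CovDerivVector (shiftEquiv)
open B9Eq352DivFormLetters (conj gradLetterF gradLetterB gradLetterF_apply gradLetterB_apply)
open B9Eq352GradLetters (diffLetter diffLetter_inl diffLetter_inr)
open B9Eq324PenaltyKernelForm (readA readA_apply)
open B9Eq357QprimeTowerKernelForm (blkK)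
open B9Eq341TowerBlockGeometry (towerGeom len_towerGeom dist_towerGeom tdist1_le_card_mul_tdist blkK_eq_blockCoord_siteCast)
open B9Eq342MajorantReadingSeam (hasMajorant_conj_of_blockRow)
open B9Eq342TowerGradientRowMajorant (norm_R_le_of_norm_le_one tdist_blkK_shift_le_one)
open B9Eq323SiteLaplacianJunction (phi_covDivL2K)
open B9Eq349LaplacePrimeBlockLetters (card_tdist_le_one_le)

/-! ## §1 The backward difference of a site function as the covariant divergence of a one-direction bond field -/

section Algebra

variable {𝔸 : Type*} [NormedRing 𝔸] [NormedAlgebra ℂ 𝔸] {S ι : Type*} (T : ι → Equiv.Perm S) (V : ι → S → 𝔸ˣ)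

omit [NormedAlgebra ℂ 𝔸] in
/-- `D*_ν 0 = 0`. [folklore] [cite: Balaban1985BackgroundPropagators, (3.8) p.392] -/
theorem covDstar_zero_fun [Algebra ℂ 𝔸] (ν : ι) (x : S) : covDstar T V ν (fun _ : S => (0 : 𝔸)) x = 0 := by
  simp [covDstar]

omit [NormedAlgebra ℂ 𝔸] in
/-- **`D_μg = D*_μa′` with `a′(z) = −R(U_μ(z))·g(T_μz)`** — the forward covariant difference of a site function is the backward one of its transported shift.
[cite: Balaban1985BackgroundPropagators, (3.3) p.390, (3.8) p.392] -/
theorem covD_eq_covDstar_antider [Algebra ℂ 𝔸] (μ : ι) (g : S → 𝔸) (y : S) :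
    covD T V μ g y = covDstar T V μ (fun z => -R (V μ z) (g (T μ z))) y := by
  simp only [covD, covDstar, R_neg, R_inv_R, Equiv.apply_symm_apply]
  abel

end Algebra

section Reading

variable {d : ℕ} {P : Fin d → ℕ} {𝔸 : Type*} [NormedRing 𝔸] [NormedAlgebra ℂ 𝔸] {W : Type*} [NormedAddCommGroup W] [InnerProductSpace ℂ W]
  (φ : W ≃ₗ[ℂ] 𝔸) {c₀ : ℝ} [Fact (0 < c₀)] (η : ℝ) (U : Bond d P → 𝔸ˣ) (μ : Fin d)

/-- **`(readA φ G)(η⁻¹D*_μw)(x) = φ((G(D*_U A_w))(x))`** for the one-direction bond field `A_w(z, ν) = δ_{νμ}φ⁻¹(w z)` — the backward difference letter applied BEFORE an operator of the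
chain is that operator after the chain's covariant divergence (`phi_covDivL2K`). [cite: Balaban1985BackgroundPropagators, (3.8) p.392, (3.42) p.397] -/
theorem phi_G_covDivL2K_single (G : SiteL2K ℂ d P c₀ W →ₗ[ℂ] SiteL2K ℂ d P c₀ W) (w : TSite d P → 𝔸) (x : TSite d P) :
    readA φ G (fun y => ((η : ℂ))⁻¹ • covDstar (fun μ => shiftEquiv (Pd := P) μ) (fun μ y => U (y, μ)) μ w y) x =
      φ (WL2.equiv ℂ (fun _ : TSite d P => c₀) W (G (covDivL2K ℂ c₀ ((η : ℂ))⁻¹ (adTransportW φ fun b => (U b)⁻¹)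
        ((WL2.equiv ℂ (fun _ : Bond d P => c₀) W).symm fun bd => if bd.2 = μ then φ.symm (w bd.1) else 0))) x) := by
  have hs : ((WL2.equiv ℂ (fun _ : TSite d P => c₀) W).symm fun y =>
        φ.symm (((η : ℂ))⁻¹ • covDstar (fun μ => shiftEquiv (Pd := P) μ) (fun μ y => U (y, μ)) μ w y)) =
      covDivL2K ℂ c₀ ((η : ℂ))⁻¹ (adTransportW φ fun b => (U b)⁻¹)
        ((WL2.equiv ℂ (fun _ : Bond d P => c₀) W).symm fun bd => if bd.2 = μ then φ.symm (w bd.1) else 0) := by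
    apply (WL2.equiv ℂ (fun _ : TSite d P => c₀) W).injective
    funext y
    apply φ.injective
    rw [Equiv.apply_symm_apply, LinearEquiv.apply_symm_apply, phi_covDivL2K]
    congr 1
    rw [Finset.sum_eq_single μ]
    · congr 1
      funext z
      rw [Equiv.apply_symm_apply, if_pos rfl, LinearEquiv.apply_symm_apply]
    · intro ν _ hν
      have h0 : (fun z => φ (WL2.equiv ℂ (fun _ : Bond d P => c₀) W
          ((WL2.equiv ℂ (fun _ : Bond d P => c₀) W).symm fun bd => if bd.2 = μ then φ.symm (w bd.1) else 0) (z, ν))) = fun _ => (0 : 𝔸) := by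
        funext z
        rw [Equiv.apply_symm_apply, if_neg hν, map_zero]
      rw [h0, covDstar_zero_fun]
    · intro h; exact absurd (Finset.mem_univ μ) h
  rw [readA_apply, hs]

end Reading

/-! ## §2 `h342_3` at the chain's `G′_k(U)` -/

section Main

variable {d : ℕ} (L : ℕ) [NeZero L] {𝔸 : Type*} [NormedRing 𝔸] [NormedAlgebra ℂ 𝔸] [CompleteSpace 𝔸] [NormOneClass 𝔸] [StarRing 𝔸]
  {W : Type*} [NormedAddCommGroup W] [InnerProductSpace ℂ W] [FiniteDimensional ℂ W] (φ : W ≃ₗ[ℂ] 𝔸) {a' Mφ Mφ' : ℝ}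
  (hMφ : 0 ≤ Mφ) (hMφ' : 0 ≤ Mφ') (hφn : ∀ w, ‖φ w‖ ≤ Mφ * ‖w‖) (hφn' : ∀ X, ‖φ.symm X‖ ≤ Mφ' * ‖X‖) (ha' : 0 < a')
  {r : ℝ} (hr0 : 0 ≤ r) (hr1 : r < 1)
  (τ : 𝔸 →ₗ[ℂ] ℂ) (hτ₂ : ∀ X Y : 𝔸, τ (X * Y) = τ (Y * X)) (hφτ : ∀ X Y : 𝔸, ⟪φ.symm X, φ.symm Y⟫_ℂ = τ (star X * Y))
  {ι : Type} [Fintype ι] (b : Module.Basis ι ℝ 𝔸) {M₂ : ℝ} (hM₂ : 0 ≤ M₂) (hrepr : ∀ (v : 𝔸) (i : ι), |b.repr v i| ≤ M₂ * ‖v‖)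

include hMφ hMφ' hφn hφn' ha' hr0 hr1 hτ₂ hφτ hM₂ hrepr in
/-- **`h342_3` OF `thm34_Gp_uniform` AT THE CHAIN's `G′_k(U)`, CONSTANTS BEFORE THE HEIGHT, ON PRINT's CLASS** — see the module docstring.
[cite: Balaban1985BackgroundPropagators, Thm 3.1 (3.42) p.397, (3.3) p.390, (3.8) p.392, (3.49) p.399; Balaban1984PropagatorsII, (2.51) p.232] -/
theorem exists_hasMajorant_GpOfUk_diffLetter (hd : 1 ≤ d) (hL3 : 3 ≤ L) :
    ∃ αa BG δ₀ : ℝ, 0 < αa ∧ 0 < BG ∧ 0 < δ₀ ∧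
      ∀ (n : ℕ) (η : ℝ), η * (L : ℝ) ^ (n + 1) = 1 →
      ∀ (c₀ c₁ : ℝ) [Fact (0 < c₀)] [Fact (0 < c₁)], c₀ * ((L : ℝ) ^ (n + 1)) ^ d = c₁ →
      ∀ (m : Fin d → ℕ) [∀ i, NeZero (m i)] (U : Bond d (towerP L m (n + 1)) → 𝔸ˣ),
      ∀ (α : ℝ), 0 ≤ α → α ≤ αa → (∀ bd, U bd ∈ U1 𝔸) → (∀ bd, ‖(U bd : 𝔸) - 1‖ ≤ α * η) →
        (∀ (x : TSite d (towerP L m (n + 1))) (μ : Fin d), ‖(U (x, μ) : 𝔸) - U (unshift μ x, μ)‖ ≤ α * η ^ 2) →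
      ∀ (εU : ℕ → ℝ), (∀ j, 0 ≤ εU j) → (∀ j < n + 1, εU j ≤ α * r ^ j) →
        (∀ (j : ℕ) (bd : Bond d (towerP L m (j + 1))), ‖(UlevOf L m (n + 1) U j bd : 𝔸) - 1‖ ≤ εU j) →
        (∀ (j : ℕ) (bd : Bond d (towerP L m (j + 1))), UlevOf L m (n + 1) U j bd ∈ U1 𝔸) →
        (∀ bd, star (U bd : 𝔸) = ((U bd)⁻¹ : 𝔸ˣ)) →
        (∀ (j : ℕ) (bd : Bond d (towerP L m (j + 1))) (w : W), ‖adTransportW φ (UlevOf L m (n + 1) U j) bd w‖ ≤ ‖w‖) →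
      ∀ (hpos' : ∀ x : SiteL2K ℂ d (towerP L m (n + 1)) c₀ W, x ≠ 0 → 0 < RCLike.re ⟪x, laplacePrimeAk L m n φ η U a' (c₁ := c₁) x⟫_ℂ)
        (M Rr : ℝ) (H : Prop) (l : Fin d ⊕ Fin d),
      HasMajorant (g := toB6 (towerGeom L m n η M) Rr H) (fun p : TSite d (towerP L m (n + 1)) × ι => blkK L m n p.1)
        (conj b (readA φ (GpOfUk L m n φ η U a' (c₁ := c₁) hpos')) *
          conj b (diffLetter (fun μ => shiftEquiv (Pd := towerP L m (n + 1)) μ) (fun μ y => U (y, μ)) ((η : ℂ))⁻¹ l))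
        (fun a a' => BG * (towerGeom L m n η M).len a * Real.exp (-(δ₀ * (towerGeom L m n η M).dist a a'))) := by
  obtain ⟨αa, Ba, δa, hαa, hBa, hδa, hrow⟩ := exists_valueRow_GpOfUk_covDiv L hL3 φ (a' := a') hMφ hMφ' hφn hφn' ha' hr0 hr1 τ hτ₂ hφτ hd
  have hSb : 0 ≤ ∑ i, ‖b i‖ := Finset.sum_nonneg fun i _ => norm_nonneg _
  have hd0 : (0 : ℝ) < d := by exact_mod_cast hd
  -- the uniform row constant: `3^d e^{δ_a} M_φ M_φ′ B_a`
  set Kc : ℝ := (3 : ℝ) ^ d * Real.exp δa * (Mφ * Mφ' * Ba) with hKc_def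
  have hKc : 0 ≤ Kc := by positivity
  refine ⟨αa, M₂ * (∑ i, ‖b i‖) * Kc + 1, δa / d, hαa, by positivity, div_pos hδa hd0, ?_⟩
  intro n η hηL c₀ c₁ _ _ hdiag m _ U α hα hαle hUb hUε hUa εU hεU hεg hLε hLb hUstar hRlev hpos' M Rr H l
  have hm : ∀ i, 1 ≤ m i := fun i => Nat.one_le_iff_ne_zero.mpr (NeZero.ne (m i))
  have hrowU := hrow n η hηL c₀ c₁ hdiag m U α hα hαle hUb hUε hUa εU hεU hεg hLε hLb hUstar hRlev hpos'
  set Td : Fin d → Equiv.Perm (TSite d (towerP L m (n + 1))) := fun μ => shiftEquiv (Pd := towerP L m (n + 1)) μ with hTd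
  set Ud : Fin d → TSite d (towerP L m (n + 1)) → 𝔸ˣ := fun μ y => U (y, μ) with hUd
  set Gp := GpOfUk L m n φ η U a' (c₁ := c₁) hpos' with hGp
  -- X10 FOR A ONE-DIRECTION BOND SOURCE OVER ONE BIG BLOCK, read at `readA G′ (η⁻¹D*_μ w)`
  have hX : ∀ (μ : Fin d) (v : TSite d m) (w : TSite d (towerP L m (n + 1)) → 𝔸) (Bw : ℝ), 0 ≤ Bw →
      (∀ z, blkK L m n z ≠ v → w z = 0) → (∀ z, ‖w z‖ ≤ Bw) → ∀ x,
      ‖readA φ Gp (fun y => ((η : ℂ))⁻¹ • covDstar Td Ud μ w y) x‖ ≤ Mφ * Mφ' * Ba * Real.exp (-(δa * tdist m (blkK L m n x) v)) * Bw := by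
    intro μ v w Bw hBw hoff hbd x
    rw [hTd, hUd, phi_G_covDivL2K_single]
    set A : BondL2K ℂ d (towerP L m (n + 1)) c₀ W :=
      (WL2.equiv ℂ (fun _ : Bond d (towerP L m (n + 1)) => c₀) W).symm fun bd => if bd.2 = μ then φ.symm (w bd.1) else 0 with hA
    have hAoff : ∀ bd : Bond d (towerP L m (n + 1)), blockCoord (L ^ (n + 1)) m (siteCast (towerP_eq_fineP_pow L m (n + 1)) (bpos bd)) ≠ v →
        WL2.equiv ℂ (fun _ : Bond d (towerP L m (n + 1)) => c₀) W A bd = 0 := by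
      intro bd hbd'
      rw [← blkK_eq_blockCoord_siteCast] at hbd'
      rw [hA, Equiv.apply_symm_apply]
      by_cases h2 : bd.2 = μ
      · rw [if_pos h2, hoff bd.1 hbd', map_zero]
      · rw [if_neg h2]
    have hAbd : ∀ bd : Bond d (towerP L m (n + 1)), ‖WL2.equiv ℂ (fun _ : Bond d (towerP L m (n + 1)) => c₀) W A bd‖ ≤ Mφ' * Bw := by
      intro bd
      rw [hA, Equiv.apply_symm_apply]
      by_cases h2 : bd.2 = μ
      · rw [if_pos h2]; exact (hφn' _).trans (mul_le_mul_of_nonneg_left (hbd bd.1) hMφ')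
      · rw [if_neg h2, norm_zero]; positivity
    have h := hrowU v A (Mφ' * Bw) hAoff hAbd x
    rw [← blkK_eq_blockCoord_siteCast] at h
    calc ‖φ (WL2.equiv ℂ (fun _ : TSite d (towerP L m (n + 1)) => c₀) W
            (Gp (covDivL2K ℂ c₀ ((η : ℂ))⁻¹ (adTransportW φ fun b => (U b)⁻¹) A)) x)‖
        ≤ Mφ * ‖WL2.equiv ℂ (fun _ : TSite d (towerP L m (n + 1)) => c₀) W
            (Gp (covDivL2K ℂ c₀ ((η : ℂ))⁻¹ (adTransportW φ fun b => (U b)⁻¹) A)) x‖ := hφn _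
      _ ≤ Mφ * (Ba * Real.exp (-(δa * tdist m (blkK L m n x) v)) * (Mφ' * Bw)) := mul_le_mul_of_nonneg_left h hMφ
      _ = Mφ * Mφ' * Ba * Real.exp (-(δa * tdist m (blkK L m n x) v)) * Bw := by ring
  -- THE 𝔸-ROW OF `readA G′ ∘ ∇_l`, kernel `Kc·e^{−δ_a d_∞(blkK x, v)}`
  have hRow : ∀ (v : TSite d m) (g : TSite d (towerP L m (n + 1)) → 𝔸) (Bg : ℝ), 0 ≤ Bg →
      (∀ x, blkK L m n x ≠ v → g x = 0) → (∀ x, blkK L m n x = v → ‖g x‖ ≤ Bg) → ∀ x,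
      ‖(readA φ Gp * diffLetter Td Ud ((η : ℂ))⁻¹ l) g x‖ ≤ (Kc * Real.exp (-(δa * tdist m (blkK L m n x) v))) * Bg := by
    intro v g Bg hBg hoff hbd x
    have hgall : ∀ z, ‖g z‖ ≤ Bg := fun z => by
      by_cases hz : blkK L m n z = v
      · exact hbd z hz
      · rw [hoff z hz, norm_zero]; exact hBg
    have hone : Mφ * Mφ' * Ba ≤ Kc := by
      rw [hKc_def]
      have h3 : (1 : ℝ) ≤ (3 : ℝ) ^ d * Real.exp δa := one_le_mul_of_one_le_of_one_le (one_le_pow₀ (by norm_num)) (Real.one_le_exp hδa.le)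
      calc Mφ * Mφ' * Ba = 1 * (Mφ * Mφ' * Ba) := (one_mul _).symm
        _ ≤ (3 : ℝ) ^ d * Real.exp δa * (Mφ * Mφ' * Ba) := mul_le_mul_of_nonneg_right h3 (by positivity)
    rcases l with μ | μ
    · -- forward letter: `G′(η⁻¹D_μg) = G′(η⁻¹D*_μa′)`, `a′(z) = −R(U_μ(z))g(z + e_μ)`, summed over the neighbouring big blocks of `v`
      rw [diffLetter_inl, Module.End.mul_apply]
      set a₁ : TSite d (towerP L m (n + 1)) → 𝔸 := fun z => -R (Ud μ z) (g (Td μ z)) with ha₁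
      have ha'fun : gradLetterF Td Ud ((η : ℂ))⁻¹ μ g = gradLetterB Td Ud ((η : ℂ))⁻¹ μ a₁ := by
        funext y; rw [gradLetterF_apply, gradLetterB_apply, covD_eq_covDstar_antider]
      -- block pieces of `a′`
      have hdec : a₁ = ∑ v' : TSite d m, (fun z => if blkK L m n z = v' then a₁ z else 0) := by
        funext z; rw [Finset.sum_apply, Finset.sum_ite_eq, if_pos (Finset.mem_univ _)]
      rw [ha'fun, hdec, map_sum, map_sum, Finset.sum_apply]
      refine (norm_sum_le _ _).trans ?_
      -- each piece: X10 with the source bound `B_g` on the neighbouring blocks, `0` elsewhere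
      have hpiece : ∀ v' : TSite d m,
          ‖readA φ Gp (gradLetterB Td Ud ((η : ℂ))⁻¹ μ (fun z => if blkK L m n z = v' then a₁ z else 0)) x‖ ≤
            if tdist m v v' ≤ 1 then Mφ * Mφ' * Ba * Real.exp δa * Real.exp (-(δa * tdist m (blkK L m n x) v)) * Bg else 0 := by
        intro v'
        have hgB : gradLetterB Td Ud ((η : ℂ))⁻¹ μ (fun z => if blkK L m n z = v' then a₁ z else 0) =
            fun y => ((η : ℂ))⁻¹ • covDstar Td Ud μ (fun z => if blkK L m n z = v' then a₁ z else 0) y := by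
          funext y; rw [gradLetterB_apply]
        by_cases hv' : tdist m v v' ≤ 1
        · rw [if_pos hv', hgB]
          have h := hX μ v' (fun z => if blkK L m n z = v' then a₁ z else 0) Bg hBg
            (fun z hz => by simp only [if_neg hz]) (fun z => by
              by_cases hz : blkK L m n z = v'
              · rw [if_pos hz, ha₁, norm_neg]
                exact (norm_R_le_of_norm_le_one _ (hUb (z, μ)) _).trans (hgall _)
              · rw [if_neg hz, norm_zero]; exact hBg) x
          refine h.trans ?_
          have htri : Real.exp (-(δa * tdist m (blkK L m n x) v')) ≤ Real.exp δa * Real.exp (-(δa * tdist m (blkK L m n x) v)) := by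
            rw [← Real.exp_add]
            refine Real.exp_le_exp.mpr ?_
            have h1 : tdist m (blkK L m n x) v ≤ tdist m (blkK L m n x) v' + tdist m v' v := tdist_triangle hm _ _ _
            have h2 : tdist m v' v ≤ 1 := by rwa [tdist_symm hm]
            nlinarith [hδa.le]
          calc Mφ * Mφ' * Ba * Real.exp (-(δa * tdist m (blkK L m n x) v')) * Bg
              ≤ Mφ * Mφ' * Ba * (Real.exp δa * Real.exp (-(δa * tdist m (blkK L m n x) v))) * Bg := by gcongr
            _ = Mφ * Mφ' * Ba * Real.exp δa * Real.exp (-(δa * tdist m (blkK L m n x) v)) * Bg := by ring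
        · rw [if_neg hv']
          -- the piece vanishes: `a′` lives over blocks within one coarse unit of `v`
          have hzero : (fun z => if blkK L m n z = v' then a₁ z else 0) = 0 := by
            funext z
            rw [Pi.zero_apply]
            by_cases hz : blkK L m n z = v'
            · rw [if_pos hz, ha₁]
              by_cases hg : blkK L m n (Td μ z) = v
              · exfalso; apply hv'
                have h1 : tdist m v v' ≤ tdist m v (blkK L m n z) + tdist m (blkK L m n z) v' := tdist_triangle hm _ _ _
                have h2 : tdist m (blkK L m n z) (blkK L m n (shift μ z)) ≤ 1 := tdist_blkK_shift_le_one L m n μ z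
                have h3 : tdist m v (blkK L m n z) ≤ 1 := by
                  rw [tdist_symm hm, ← hg]; exact h2
                have h4 : tdist m (blkK L m n z) v' = 0 := by rw [hz, B4Sect5Torus.tdist_self]
                rw [h4, add_zero] at h1
                exact h1.trans h3
              · simp only [hoff _ hg, R_zero, neg_zero]
            · rw [if_neg hz]
          rw [hzero, map_zero, map_zero, Pi.zero_apply, norm_zero]
      refine (Finset.sum_le_sum fun v' _ => hpiece v').trans ?_
      rw [Finset.sum_ite, Finset.sum_const_zero, add_zero, Finset.sum_const, nsmul_eq_mul]
      have hcard : ((Finset.univ.filter fun v' : TSite d m => tdist m v v' ≤ 1).card : ℝ) ≤ (3 : ℝ) ^ d := by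
        exact_mod_cast card_tdist_le_one_le hm v
      have hE : 0 ≤ Mφ * Mφ' * Ba * Real.exp δa * Real.exp (-(δa * tdist m (blkK L m n x) v)) * Bg := by positivity
      calc ((Finset.univ.filter fun v' : TSite d m => tdist m v v' ≤ 1).card : ℝ) *
            (Mφ * Mφ' * Ba * Real.exp δa * Real.exp (-(δa * tdist m (blkK L m n x) v)) * Bg)
          ≤ (3 : ℝ) ^ d * (Mφ * Mφ' * Ba * Real.exp δa * Real.exp (-(δa * tdist m (blkK L m n x) v)) * Bg) := mul_le_mul_of_nonneg_right hcard hE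
        _ = Kc * Real.exp (-(δa * tdist m (blkK L m n x) v)) * Bg := by rw [hKc_def]; ring
    · -- backward letter: `G′(−η⁻¹D*_μg)` — X10 for the bond field `δ_{νμ}g` over the block `v` itself
      rw [diffLetter_inr, Module.End.mul_apply, LinearMap.neg_apply, map_neg, Pi.neg_apply, norm_neg]
      have hgfun : gradLetterB Td Ud ((η : ℂ))⁻¹ μ g = fun y => ((η : ℂ))⁻¹ • covDstar Td Ud μ g y := by
        funext y; rw [gradLetterB_apply]
      rw [hgfun]
      refine (hX μ v g Bg hBg hoff hgall x).trans ?_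
      have hexp0 : 0 ≤ Real.exp (-(δa * tdist m (blkK L m n x) v)) := (Real.exp_pos _).le
      exact mul_le_mul_of_nonneg_right (mul_le_mul_of_nonneg_right hone hexp0) hBg
  -- the seam and the shape of `thm34_Gp_uniform`
  have hmaj := hasMajorant_conj_of_blockRow b (G := toB6 (towerGeom L m n η M) Rr H) (blkK L m n) hM₂ hrepr
    (readA φ Gp * diffLetter Td Ud ((η : ℂ))⁻¹ l) (fun a a'' => Kc * Real.exp (-(δa * tdist m a a''))) hRow
  rw [B9Eq352DivFormLetters.conj_mul] at hmaj
  refine hasMajorant_mono _ hmaj fun a a'' => ?_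
  have hlen : (towerGeom L m n η M).len a = 1 := by rw [len_towerGeom, mul_comm]; exact hηL
  have hexp : Real.exp (-(δa * tdist m a a'')) ≤ Real.exp (-(δa / d * (towerGeom L m n η M).dist a a'')) := by
    refine Real.exp_le_exp.mpr (neg_le_neg ?_)
    rw [dist_towerGeom]
    have h1 := tdist1_le_card_mul_tdist m a a''
    calc δa / d * B9Thm37GlueTorus.tdist1 m a a'' ≤ δa / d * (d * tdist m a a'') := mul_le_mul_of_nonneg_left h1 (div_pos hδa hd0).le
      _ = δa * tdist m a a'' := by field_simp
  rw [hlen, mul_one]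
  calc M₂ * (∑ i, ‖b i‖) * (Kc * Real.exp (-(δa * tdist m a a'')))
      = (M₂ * (∑ i, ‖b i‖) * Kc) * Real.exp (-(δa * tdist m a a'')) := by ring
    _ ≤ (M₂ * (∑ i, ‖b i‖) * Kc + 1) * Real.exp (-(δa / d * (towerGeom L m n η M).dist a a'')) :=
        mul_le_mul (by linarith) hexp (Real.exp_pos _).le (by positivity)

end Main

end Literature.MathematicalPhysics.QuantumFieldTheory.Balaban1983to89.B9Eq342TowerAdjointRowMajorant

end
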